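import Summits.Parity.GeneralizedHardyLittlewood.Theorems.PrimeLevelFamEdgeMomentsBeyondDiagonalDiagRungThree
import HarnessLib

/-!
# Route `PrimeLevelFamEdge`, crux K_A `MomentsBeyondDiagonal` (stmt-Parity-20007), line «petersson_layers» v4, stub `stub_diag`:
# **RUNG `N = 4` OF THE GRADED ASSEMBLY FROM THE SIX PER-ORDER TARGETS `(2,2)`, `(1,3)`, `(3,3)`, `(0,4)`, `(2,4)`, `(4,4)`**
# (the rung-`4` twin of `…DiagRungThree`: the diagonal main term for every `Q` of degree `≤ 4`)

`(1,1)`, `(0,2)` unconditional; `(2,0)`, `(3,1)`, `(4,0)`, `(4,2)` by `…DiagOrderSymm.selbergOrder_symm` (here); the six targets are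
hypotheses with abstract functionals `𝔎_ij` (`τ_ij = Δ′²(Δ′^(i+j−2)𝔎_ij(1/Δ′,P))/(2(π²/6)²)`). Status: `(2,2)`, `(1,3)`, `(3,3)`
UNCONDITIONAL (`…RungTwoHolds`, `…OrderOneThreeHolds`, `…RungThreeHolds`; instantiate with `(by convert <target> using 12)`);
`(0,4)` ⟸ (R₀₄) (`…DecorOrderZeroFourTarget`); `(2,4)` ⟸ (R₂₄) (`…OrderTwoFourOfR24`); `(4,4)`: chain to be written on
`…DecorOrderRungFourHecke.heckeSum_orderFourFour_eq` with the landed engines (`…M4P2/M6P2/M4M4/M8Family`, …) + (R₄₄).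

* `diagPart_asymp_of_natDegree_le_four_of_targets` — **`‖diagPart q P Q Δ' − 2ζ(2)²q̂/(Δ'²ℓ²)·(Q₀²·secondMomentForm + 2Q₁²τ₁₁
  + 4Q₀Q₂τ₀₂ + 2Q₂²τ₂₂ + 4Q₁Q₃τ₁₃ + 2Q₃²τ₃₃ + 4Q₀Q₄τ₀₄ + 4Q₂Q₄τ₂₄ + 2Q₄²τ₄₄)‖ ≤ C q̂ ℓ⁻³`** (`deg Q ≤ 4`, `Δ' ∈ (1,Δ]`, `Δ ≤ 3/2`).

Def-free; helper `--supports stmt-Parity-20007`; closes nothing; K_A, K_B and the Parity summit are NOT proved; nothing about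
Landau–Siegel zeros.

## References
* E. Kowalski, P. Michel, J. VanderKam, J. reine angew. Math. 526 (2000), (23)–(28) pp. 13–15, Prop. 5.1 (31) p. 18.
  [cite: KowalskiMichelVanderKam2000, (23)–(28) pp. 13–15 — derivation (diagonal main term, Q of degree ≤ 4)]
-/

noncomputable section

open scoped Real ArithmeticFunction.Moebius
open Complex MeasureTheory Polynomial Finset ArithmeticFunction Set
open Literature.NumberTheory.LFunctions Literature.NumberTheory.LFunctions.KMV2000

namespace Summit.Parity.GeneralizedHardyLittlewood.Theorems.MomentsBeyondDiagonal.DiagLines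

open Summit.Parity.GeneralizedHardyLittlewood.Theorems.PrimeLevelFamEdgeIdeaDeltas.PeterssonLayers
  (diagPart HasShape SubOf SubDiag)
open Summit.Parity.GeneralizedHardyLittlewood.Theorems.MomentsBeyondDiagonal.DiagCorner (orderOneOne_target orderZeroTwo_target)

set_option maxHeartbeats 3000000 in
set_option maxRecDepth 8192 in
-- large statement (six target hypotheses, nine closed-form functionals) and a twenty-five-case order dispatch
/-- **RUNG `N = 4` MODULO THE TARGETS `(2,2)`, `(1,3)`, `(3,3)`, `(0,4)`, `(2,4)`, `(4,4)`** (see the module docstring; `Δ ≤ 3/2`,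
`deg Q ≤ 4`). [cite: KowalskiMichelVanderKam2000, (23)–(28) pp. 13–15, Prop. 5.1 (31) — derivation (diagonal main term, Q of degree ≤ 4)] -/
theorem diagPart_asymp_of_natDegree_le_four_of_targets {Δ : ℝ} (hΔ : Δ ≤ 3 / 2)
    (𝔎₂₂ 𝔎₁₃ 𝔎₃₃ 𝔎₀₄ 𝔎₂₄ 𝔎₄₄ : ℝ → ℝ[X] → ℝ)
    (h22 : ∀ P : ℝ[X], KMV2000.Admissible P → ∀ Δ' : ℝ, 1 < Δ' → Δ' ≤ Δ →
      ∃ C : ℝ, ∃ q₀ : ℕ, ∀ (q : ℕ) [NeZero q], q₀ ≤ q →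
        |(Real.log (qhat q))⁻¹ ^ (2 + 2) * qhat q *
          (∑ c ∈ Icc 1 ⌊qhat q ^ Δ'⌋₊, ∑ g ∈ Icc 1 (⌊qhat q ^ Δ'⌋₊ / c), (μ g : ℝ) * c *
        ∑ k₁ ∈ Icc 1 (⌊qhat q ^ Δ'⌋₊ / (c * g)), ∑ k₂ ∈ Icc 1 (⌊qhat q ^ Δ'⌋₊ / (c * g)),
          ((μ (c * g * k₁) : ℝ) * ((psi (c * g * k₁))⁻¹ *
              P.eval (Real.log (qhat q ^ Δ' / ((c * g * k₁ : ℕ) : ℝ)) / Real.log (qhat q ^ Δ'))) / ((c * g * k₁ : ℕ) : ℝ)) *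
            ((μ (c * g * k₂) : ℝ) * ((psi (c * g * k₂))⁻¹ *
              P.eval (Real.log (qhat q ^ Δ' / ((c * g * k₂ : ℕ) : ℝ)) / Real.log (qhat q ^ Δ'))) / ((c * g * k₂ : ℕ) : ℝ)) *
            (∑ d ∈ k₁.divisors, ∑ e ∈ k₂.divisors,
              ∫ u₁ in Ioi (0 : ℝ),
                (Real.log (qhat q / ((k₁ / d * (g * e) : ℕ) : ℝ)) + Real.log u₁) ^ 2 *
                ∫ u₂ in Ioi ((((k₁ / d * (g * e) * (g * d * (k₂ / e)) : ℕ) : ℝ) / qhat q ^ 2) / u₁),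
                  Real.exp (-(u₁ + u₂)) / (1 - Real.exp (-(u₁ + u₂))) ^ 2 *
                  (Real.log (qhat q / ((g * d * (k₂ / e) : ℕ) : ℝ)) + Real.log u₂) ^ 2)) -
          2 * (π ^ 2 / 6) ^ 2 * (qhat q / (Δ' ^ 2 * Real.log (qhat q) ^ 2)) *
            (Δ' ^ 2 * (Δ' ^ 2 * 𝔎₂₂ (1 / Δ') P) / (2 * (π ^ 2 / 6) ^ 2))| ≤
          C * qhat q * (Real.log (qhat q))⁻¹ ^ 3)
    (h13 : ∀ P : ℝ[X], KMV2000.Admissible P → ∀ Δ' : ℝ, 1 < Δ' → Δ' ≤ Δ →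
      ∃ C : ℝ, ∃ q₀ : ℕ, ∀ (q : ℕ) [NeZero q], q₀ ≤ q →
        |(Real.log (qhat q))⁻¹ ^ (1 + 3) * qhat q *
          (∑ c ∈ Icc 1 ⌊qhat q ^ Δ'⌋₊, ∑ g ∈ Icc 1 (⌊qhat q ^ Δ'⌋₊ / c), (μ g : ℝ) * c *
        ∑ k₁ ∈ Icc 1 (⌊qhat q ^ Δ'⌋₊ / (c * g)), ∑ k₂ ∈ Icc 1 (⌊qhat q ^ Δ'⌋₊ / (c * g)),
          ((μ (c * g * k₁) : ℝ) * ((psi (c * g * k₁))⁻¹ *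
              P.eval (Real.log (qhat q ^ Δ' / ((c * g * k₁ : ℕ) : ℝ)) / Real.log (qhat q ^ Δ'))) / ((c * g * k₁ : ℕ) : ℝ)) *
            ((μ (c * g * k₂) : ℝ) * ((psi (c * g * k₂))⁻¹ *
              P.eval (Real.log (qhat q ^ Δ' / ((c * g * k₂ : ℕ) : ℝ)) / Real.log (qhat q ^ Δ'))) / ((c * g * k₂ : ℕ) : ℝ)) *
            (∑ d ∈ k₁.divisors, ∑ e ∈ k₂.divisors,
              ∫ u₁ in Ioi (0 : ℝ),
                (Real.log (qhat q / ((k₁ / d * (g * e) : ℕ) : ℝ)) + Real.log u₁) ^ 1 *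
                ∫ u₂ in Ioi ((((k₁ / d * (g * e) * (g * d * (k₂ / e)) : ℕ) : ℝ) / qhat q ^ 2) / u₁),
                  Real.exp (-(u₁ + u₂)) / (1 - Real.exp (-(u₁ + u₂))) ^ 2 *
                  (Real.log (qhat q / ((g * d * (k₂ / e) : ℕ) : ℝ)) + Real.log u₂) ^ 3)) -
          2 * (π ^ 2 / 6) ^ 2 * (qhat q / (Δ' ^ 2 * Real.log (qhat q) ^ 2)) *
            (Δ' ^ 2 * (Δ' ^ 2 * 𝔎₁₃ (1 / Δ') P) / (2 * (π ^ 2 / 6) ^ 2))| ≤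
          C * qhat q * (Real.log (qhat q))⁻¹ ^ 3)
    (h33 : ∀ P : ℝ[X], KMV2000.Admissible P → ∀ Δ' : ℝ, 1 < Δ' → Δ' ≤ Δ →
      ∃ C : ℝ, ∃ q₀ : ℕ, ∀ (q : ℕ) [NeZero q], q₀ ≤ q →
        |(Real.log (qhat q))⁻¹ ^ (3 + 3) * qhat q *
          (∑ c ∈ Icc 1 ⌊qhat q ^ Δ'⌋₊, ∑ g ∈ Icc 1 (⌊qhat q ^ Δ'⌋₊ / c), (μ g : ℝ) * c *
        ∑ k₁ ∈ Icc 1 (⌊qhat q ^ Δ'⌋₊ / (c * g)), ∑ k₂ ∈ Icc 1 (⌊qhat q ^ Δ'⌋₊ / (c * g)),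
          ((μ (c * g * k₁) : ℝ) * ((psi (c * g * k₁))⁻¹ *
              P.eval (Real.log (qhat q ^ Δ' / ((c * g * k₁ : ℕ) : ℝ)) / Real.log (qhat q ^ Δ'))) / ((c * g * k₁ : ℕ) : ℝ)) *
            ((μ (c * g * k₂) : ℝ) * ((psi (c * g * k₂))⁻¹ *
              P.eval (Real.log (qhat q ^ Δ' / ((c * g * k₂ : ℕ) : ℝ)) / Real.log (qhat q ^ Δ'))) / ((c * g * k₂ : ℕ) : ℝ)) *
            (∑ d ∈ k₁.divisors, ∑ e ∈ k₂.divisors,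
              ∫ u₁ in Ioi (0 : ℝ),
                (Real.log (qhat q / ((k₁ / d * (g * e) : ℕ) : ℝ)) + Real.log u₁) ^ 3 *
                ∫ u₂ in Ioi ((((k₁ / d * (g * e) * (g * d * (k₂ / e)) : ℕ) : ℝ) / qhat q ^ 2) / u₁),
                  Real.exp (-(u₁ + u₂)) / (1 - Real.exp (-(u₁ + u₂))) ^ 2 *
                  (Real.log (qhat q / ((g * d * (k₂ / e) : ℕ) : ℝ)) + Real.log u₂) ^ 3)) -
          2 * (π ^ 2 / 6) ^ 2 * (qhat q / (Δ' ^ 2 * Real.log (qhat q) ^ 2)) *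
            (Δ' ^ 2 * (Δ' ^ 4 * 𝔎₃₃ (1 / Δ') P) / (2 * (π ^ 2 / 6) ^ 2))| ≤
          C * qhat q * (Real.log (qhat q))⁻¹ ^ 3)
    (h04 : ∀ P : ℝ[X], KMV2000.Admissible P → ∀ Δ' : ℝ, 1 < Δ' → Δ' ≤ Δ →
      ∃ C : ℝ, ∃ q₀ : ℕ, ∀ (q : ℕ) [NeZero q], q₀ ≤ q →
        |(Real.log (qhat q))⁻¹ ^ (0 + 4) * qhat q *
          (∑ c ∈ Icc 1 ⌊qhat q ^ Δ'⌋₊, ∑ g ∈ Icc 1 (⌊qhat q ^ Δ'⌋₊ / c), (μ g : ℝ) * c *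
        ∑ k₁ ∈ Icc 1 (⌊qhat q ^ Δ'⌋₊ / (c * g)), ∑ k₂ ∈ Icc 1 (⌊qhat q ^ Δ'⌋₊ / (c * g)),
          ((μ (c * g * k₁) : ℝ) * ((psi (c * g * k₁))⁻¹ *
              P.eval (Real.log (qhat q ^ Δ' / ((c * g * k₁ : ℕ) : ℝ)) / Real.log (qhat q ^ Δ'))) / ((c * g * k₁ : ℕ) : ℝ)) *
            ((μ (c * g * k₂) : ℝ) * ((psi (c * g * k₂))⁻¹ *
              P.eval (Real.log (qhat q ^ Δ' / ((c * g * k₂ : ℕ) : ℝ)) / Real.log (qhat q ^ Δ'))) / ((c * g * k₂ : ℕ) : ℝ)) *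
            (∑ d ∈ k₁.divisors, ∑ e ∈ k₂.divisors,
              ∫ u₁ in Ioi (0 : ℝ),
                (Real.log (qhat q / ((k₁ / d * (g * e) : ℕ) : ℝ)) + Real.log u₁) ^ 0 *
                ∫ u₂ in Ioi ((((k₁ / d * (g * e) * (g * d * (k₂ / e)) : ℕ) : ℝ) / qhat q ^ 2) / u₁),
                  Real.exp (-(u₁ + u₂)) / (1 - Real.exp (-(u₁ + u₂))) ^ 2 *
                  (Real.log (qhat q / ((g * d * (k₂ / e) : ℕ) : ℝ)) + Real.log u₂) ^ 4)) -
          2 * (π ^ 2 / 6) ^ 2 * (qhat q / (Δ' ^ 2 * Real.log (qhat q) ^ 2)) *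
            (Δ' ^ 2 * (Δ' ^ 2 * 𝔎₀₄ (1 / Δ') P) / (2 * (π ^ 2 / 6) ^ 2))| ≤
          C * qhat q * (Real.log (qhat q))⁻¹ ^ 3)
    (h24 : ∀ P : ℝ[X], KMV2000.Admissible P → ∀ Δ' : ℝ, 1 < Δ' → Δ' ≤ Δ →
      ∃ C : ℝ, ∃ q₀ : ℕ, ∀ (q : ℕ) [NeZero q], q₀ ≤ q →
        |(Real.log (qhat q))⁻¹ ^ (2 + 4) * qhat q *
          (∑ c ∈ Icc 1 ⌊qhat q ^ Δ'⌋₊, ∑ g ∈ Icc 1 (⌊qhat q ^ Δ'⌋₊ / c), (μ g : ℝ) * c *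
        ∑ k₁ ∈ Icc 1 (⌊qhat q ^ Δ'⌋₊ / (c * g)), ∑ k₂ ∈ Icc 1 (⌊qhat q ^ Δ'⌋₊ / (c * g)),
          ((μ (c * g * k₁) : ℝ) * ((psi (c * g * k₁))⁻¹ *
              P.eval (Real.log (qhat q ^ Δ' / ((c * g * k₁ : ℕ) : ℝ)) / Real.log (qhat q ^ Δ'))) / ((c * g * k₁ : ℕ) : ℝ)) *
            ((μ (c * g * k₂) : ℝ) * ((psi (c * g * k₂))⁻¹ *
              P.eval (Real.log (qhat q ^ Δ' / ((c * g * k₂ : ℕ) : ℝ)) / Real.log (qhat q ^ Δ'))) / ((c * g * k₂ : ℕ) : ℝ)) *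
            (∑ d ∈ k₁.divisors, ∑ e ∈ k₂.divisors,
              ∫ u₁ in Ioi (0 : ℝ),
                (Real.log (qhat q / ((k₁ / d * (g * e) : ℕ) : ℝ)) + Real.log u₁) ^ 2 *
                ∫ u₂ in Ioi ((((k₁ / d * (g * e) * (g * d * (k₂ / e)) : ℕ) : ℝ) / qhat q ^ 2) / u₁),
                  Real.exp (-(u₁ + u₂)) / (1 - Real.exp (-(u₁ + u₂))) ^ 2 *
                  (Real.log (qhat q / ((g * d * (k₂ / e) : ℕ) : ℝ)) + Real.log u₂) ^ 4)) -
          2 * (π ^ 2 / 6) ^ 2 * (qhat q / (Δ' ^ 2 * Real.log (qhat q) ^ 2)) *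
            (Δ' ^ 2 * (Δ' ^ 4 * 𝔎₂₄ (1 / Δ') P) / (2 * (π ^ 2 / 6) ^ 2))| ≤
          C * qhat q * (Real.log (qhat q))⁻¹ ^ 3)
    (h44 : ∀ P : ℝ[X], KMV2000.Admissible P → ∀ Δ' : ℝ, 1 < Δ' → Δ' ≤ Δ →
      ∃ C : ℝ, ∃ q₀ : ℕ, ∀ (q : ℕ) [NeZero q], q₀ ≤ q →
        |(Real.log (qhat q))⁻¹ ^ (4 + 4) * qhat q *
          (∑ c ∈ Icc 1 ⌊qhat q ^ Δ'⌋₊, ∑ g ∈ Icc 1 (⌊qhat q ^ Δ'⌋₊ / c), (μ g : ℝ) * c *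
        ∑ k₁ ∈ Icc 1 (⌊qhat q ^ Δ'⌋₊ / (c * g)), ∑ k₂ ∈ Icc 1 (⌊qhat q ^ Δ'⌋₊ / (c * g)),
          ((μ (c * g * k₁) : ℝ) * ((psi (c * g * k₁))⁻¹ *
              P.eval (Real.log (qhat q ^ Δ' / ((c * g * k₁ : ℕ) : ℝ)) / Real.log (qhat q ^ Δ'))) / ((c * g * k₁ : ℕ) : ℝ)) *
            ((μ (c * g * k₂) : ℝ) * ((psi (c * g * k₂))⁻¹ *
              P.eval (Real.log (qhat q ^ Δ' / ((c * g * k₂ : ℕ) : ℝ)) / Real.log (qhat q ^ Δ'))) / ((c * g * k₂ : ℕ) : ℝ)) *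
            (∑ d ∈ k₁.divisors, ∑ e ∈ k₂.divisors,
              ∫ u₁ in Ioi (0 : ℝ),
                (Real.log (qhat q / ((k₁ / d * (g * e) : ℕ) : ℝ)) + Real.log u₁) ^ 4 *
                ∫ u₂ in Ioi ((((k₁ / d * (g * e) * (g * d * (k₂ / e)) : ℕ) : ℝ) / qhat q ^ 2) / u₁),
                  Real.exp (-(u₁ + u₂)) / (1 - Real.exp (-(u₁ + u₂))) ^ 2 *
                  (Real.log (qhat q / ((g * d * (k₂ / e) : ℕ) : ℝ)) + Real.log u₂) ^ 4)) -
          2 * (π ^ 2 / 6) ^ 2 * (qhat q / (Δ' ^ 2 * Real.log (qhat q) ^ 2)) *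
            (Δ' ^ 2 * (Δ' ^ 6 * 𝔎₄₄ (1 / Δ') P) / (2 * (π ^ 2 / 6) ^ 2))| ≤
          C * qhat q * (Real.log (qhat q))⁻¹ ^ 3)
    {P Q : ℝ[X]} (hP : KMV2000.Admissible P) (hQ : Q.natDegree ≤ 4) {Δ' : ℝ} (h1 : 1 < Δ') (h2 : Δ' ≤ Δ) :
    ∃ C : ℝ, ∃ q₀ : ℕ, ∀ (q : ℕ) [NeZero q], q₀ ≤ q →
      ‖diagPart q P Q Δ' -
          ((2 * riemannZeta 2 ^ 2 *
              ((qhat q / (Δ' ^ 2 * Real.log (qhat q) ^ 2) : ℝ) : ℂ)) *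
            ((Q.coeff 0 ^ 2 * KMV2000.secondMomentForm Δ' P 1 +
              2 * Q.coeff 1 ^ 2 *
                (Δ' ^ 2 * ((π ^ 2 / 6) ^ 2 *
              ((∑ j ∈ Finset.range (3 + 1), ∑ i ∈ Finset.range (j + 1),
                  ((3 : ℕ).choose j : ℝ) * (j.choose i : ℝ) * 2 ^ (3 - j) *
                    ∫ u in (0 : ℝ)..1, (((Polynomial.C (1 / Δ') - X) ^ (3 - j) *
                      derivative (derivative (X ^ i * P))) * derivative (derivative (X ^ (j - i) * P))).eval u) / 24 -
                (∑ j ∈ Finset.range (1 + 1), ∑ i ∈ Finset.range (j + 1),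
                  ((1 : ℕ).choose j : ℝ) * (j.choose i : ℝ) * 2 ^ (1 - j) *
                    ∫ u in (0 : ℝ)..1, (((Polynomial.C (1 / Δ') - X) ^ (1 - j) * (-(2 : ℝ) • (X ^ i * P))) *
                      derivative (derivative (X ^ (j - i) * P))).eval u) / 4)) / (2 * (π ^ 2 / 6) ^ 2)) +
              4 * (Q.coeff 0 * Q.coeff 2) *
                (Δ' ^ 2 * ((π ^ 2 / 6) ^ 2 *
              ((∑ j ∈ Finset.range (3 + 1), ∑ i ∈ Finset.range (j + 1),
                  ((3 : ℕ).choose j : ℝ) * (j.choose i : ℝ) * 2 ^ (3 - j) *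
                    ∫ u in (0 : ℝ)..1, (((Polynomial.C (1 / Δ') - X) ^ (3 - j) *
                      derivative (derivative (X ^ i * P))) * derivative (derivative (X ^ (j - i) * P))).eval u) / 24 +
                (∑ j ∈ Finset.range (1 + 1), ∑ i ∈ Finset.range (j + 1),
                  ((1 : ℕ).choose j : ℝ) * (j.choose i : ℝ) * 2 ^ (1 - j) *
                    ∫ u in (0 : ℝ)..1, (((Polynomial.C (1 / Δ') - X) ^ (1 - j) * (-(2 : ℝ) • (X ^ i * P))) *
                      derivative (derivative (X ^ (j - i) * P))).eval u) / 4)) / (2 * (π ^ 2 / 6) ^ 2)) +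
              2 * Q.coeff 2 ^ 2 *
                (Δ' ^ 2 * (Δ' ^ 2 * 𝔎₂₂ (1 / Δ') P) / (2 * (π ^ 2 / 6) ^ 2)) +
              4 * (Q.coeff 1 * Q.coeff 3) *
                (Δ' ^ 2 * (Δ' ^ 2 * 𝔎₁₃ (1 / Δ') P) / (2 * (π ^ 2 / 6) ^ 2)) +
              2 * Q.coeff 3 ^ 2 *
                (Δ' ^ 2 * (Δ' ^ 4 * 𝔎₃₃ (1 / Δ') P) / (2 * (π ^ 2 / 6) ^ 2)) +
              4 * (Q.coeff 0 * Q.coeff 4) *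
                (Δ' ^ 2 * (Δ' ^ 2 * 𝔎₀₄ (1 / Δ') P) / (2 * (π ^ 2 / 6) ^ 2)) +
              4 * (Q.coeff 2 * Q.coeff 4) *
                (Δ' ^ 2 * (Δ' ^ 4 * 𝔎₂₄ (1 / Δ') P) / (2 * (π ^ 2 / 6) ^ 2)) +
              2 * Q.coeff 4 ^ 2 *
                (Δ' ^ 2 * (Δ' ^ 6 * 𝔎₄₄ (1 / Δ') P) / (2 * (π ^ 2 / 6) ^ 2)) : ℝ) : ℂ))‖ ≤
        C * qhat q * (Real.log (qhat q))⁻¹ ^ 3 := by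
  obtain ⟨τ, hτ⟩ : ∃ τ : ℕ → ℕ → ℝ → ℝ[X] → ℝ, τ = fun i j Δ' P ↦
    if i = 1 ∧ j = 1 then
      (Δ' ^ 2 * ((π ^ 2 / 6) ^ 2 *
              ((∑ j ∈ Finset.range (3 + 1), ∑ i ∈ Finset.range (j + 1),
                  ((3 : ℕ).choose j : ℝ) * (j.choose i : ℝ) * 2 ^ (3 - j) *
                    ∫ u in (0 : ℝ)..1, (((Polynomial.C (1 / Δ') - X) ^ (3 - j) *
                      derivative (derivative (X ^ i * P))) * derivative (derivative (X ^ (j - i) * P))).eval u) / 24 -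
                (∑ j ∈ Finset.range (1 + 1), ∑ i ∈ Finset.range (j + 1),
                  ((1 : ℕ).choose j : ℝ) * (j.choose i : ℝ) * 2 ^ (1 - j) *
                    ∫ u in (0 : ℝ)..1, (((Polynomial.C (1 / Δ') - X) ^ (1 - j) * (-(2 : ℝ) • (X ^ i * P))) *
                      derivative (derivative (X ^ (j - i) * P))).eval u) / 4)) / (2 * (π ^ 2 / 6) ^ 2))
    else if i = 2 ∧ j = 2 then
      (Δ' ^ 2 * (Δ' ^ 2 * 𝔎₂₂ (1 / Δ') P) / (2 * (π ^ 2 / 6) ^ 2))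
    else if i + j = 2 then
      (Δ' ^ 2 * ((π ^ 2 / 6) ^ 2 *
              ((∑ j ∈ Finset.range (3 + 1), ∑ i ∈ Finset.range (j + 1),
                  ((3 : ℕ).choose j : ℝ) * (j.choose i : ℝ) * 2 ^ (3 - j) *
                    ∫ u in (0 : ℝ)..1, (((Polynomial.C (1 / Δ') - X) ^ (3 - j) *
                      derivative (derivative (X ^ i * P))) * derivative (derivative (X ^ (j - i) * P))).eval u) / 24 +
                (∑ j ∈ Finset.range (1 + 1), ∑ i ∈ Finset.range (j + 1),
                  ((1 : ℕ).choose j : ℝ) * (j.choose i : ℝ) * 2 ^ (1 - j) *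
                    ∫ u in (0 : ℝ)..1, (((Polynomial.C (1 / Δ') - X) ^ (1 - j) * (-(2 : ℝ) • (X ^ i * P))) *
                      derivative (derivative (X ^ (j - i) * P))).eval u) / 4)) / (2 * (π ^ 2 / 6) ^ 2))
    else if i = 3 ∧ j = 3 then
      (Δ' ^ 2 * (Δ' ^ 4 * 𝔎₃₃ (1 / Δ') P) / (2 * (π ^ 2 / 6) ^ 2))
    else if i = 0 ∧ j = 4 then
      (Δ' ^ 2 * (Δ' ^ 2 * 𝔎₀₄ (1 / Δ') P) / (2 * (π ^ 2 / 6) ^ 2))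
    else if i = 4 ∧ j = 0 then
      (Δ' ^ 2 * (Δ' ^ 2 * 𝔎₀₄ (1 / Δ') P) / (2 * (π ^ 2 / 6) ^ 2))
    else if i + j = 4 then
      (Δ' ^ 2 * (Δ' ^ 2 * 𝔎₁₃ (1 / Δ') P) / (2 * (π ^ 2 / 6) ^ 2))
    else if i = 4 ∧ j = 4 then
      (Δ' ^ 2 * (Δ' ^ 6 * 𝔎₄₄ (1 / Δ') P) / (2 * (π ^ 2 / 6) ^ 2))
    else if i + j = 6 then
      (Δ' ^ 2 * (Δ' ^ 4 * 𝔎₂₄ (1 / Δ') P) / (2 * (π ^ 2 / 6) ^ 2))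
    else KMV2000.secondMomentForm Δ' P 1 / 2 := ⟨_, rfl⟩
  have t00 : ∀ (Δ' : ℝ) (P : ℝ[X]), τ 0 0 Δ' P =
      KMV2000.secondMomentForm Δ' P 1 / 2 := fun _ _ ↦ by rw [hτ]; norm_num
  have t11 : ∀ (Δ' : ℝ) (P : ℝ[X]), τ 1 1 Δ' P =
      (Δ' ^ 2 * ((π ^ 2 / 6) ^ 2 *
              ((∑ j ∈ Finset.range (3 + 1), ∑ i ∈ Finset.range (j + 1),
                  ((3 : ℕ).choose j : ℝ) * (j.choose i : ℝ) * 2 ^ (3 - j) *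
                    ∫ u in (0 : ℝ)..1, (((Polynomial.C (1 / Δ') - X) ^ (3 - j) *
                      derivative (derivative (X ^ i * P))) * derivative (derivative (X ^ (j - i) * P))).eval u) / 24 -
                (∑ j ∈ Finset.range (1 + 1), ∑ i ∈ Finset.range (j + 1),
                  ((1 : ℕ).choose j : ℝ) * (j.choose i : ℝ) * 2 ^ (1 - j) *
                    ∫ u in (0 : ℝ)..1, (((Polynomial.C (1 / Δ') - X) ^ (1 - j) * (-(2 : ℝ) • (X ^ i * P))) *
                      derivative (derivative (X ^ (j - i) * P))).eval u) / 4)) / (2 * (π ^ 2 / 6) ^ 2)) := fun _ _ ↦ by rw [hτ]; norm_num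
  have t22 : ∀ (Δ' : ℝ) (P : ℝ[X]), τ 2 2 Δ' P =
      (Δ' ^ 2 * (Δ' ^ 2 * 𝔎₂₂ (1 / Δ') P) / (2 * (π ^ 2 / 6) ^ 2)) := fun _ _ ↦ by rw [hτ]; norm_num
  have t02 : ∀ (Δ' : ℝ) (P : ℝ[X]), τ 0 2 Δ' P =
      (Δ' ^ 2 * ((π ^ 2 / 6) ^ 2 *
              ((∑ j ∈ Finset.range (3 + 1), ∑ i ∈ Finset.range (j + 1),
                  ((3 : ℕ).choose j : ℝ) * (j.choose i : ℝ) * 2 ^ (3 - j) *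
                    ∫ u in (0 : ℝ)..1, (((Polynomial.C (1 / Δ') - X) ^ (3 - j) *
                      derivative (derivative (X ^ i * P))) * derivative (derivative (X ^ (j - i) * P))).eval u) / 24 +
                (∑ j ∈ Finset.range (1 + 1), ∑ i ∈ Finset.range (j + 1),
                  ((1 : ℕ).choose j : ℝ) * (j.choose i : ℝ) * 2 ^ (1 - j) *
                    ∫ u in (0 : ℝ)..1, (((Polynomial.C (1 / Δ') - X) ^ (1 - j) * (-(2 : ℝ) • (X ^ i * P))) *
                      derivative (derivative (X ^ (j - i) * P))).eval u) / 4)) / (2 * (π ^ 2 / 6) ^ 2)) := fun _ _ ↦ by rw [hτ]; norm_num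
  have t20 : ∀ (Δ' : ℝ) (P : ℝ[X]), τ 2 0 Δ' P =
      (Δ' ^ 2 * ((π ^ 2 / 6) ^ 2 *
              ((∑ j ∈ Finset.range (3 + 1), ∑ i ∈ Finset.range (j + 1),
                  ((3 : ℕ).choose j : ℝ) * (j.choose i : ℝ) * 2 ^ (3 - j) *
                    ∫ u in (0 : ℝ)..1, (((Polynomial.C (1 / Δ') - X) ^ (3 - j) *
                      derivative (derivative (X ^ i * P))) * derivative (derivative (X ^ (j - i) * P))).eval u) / 24 +
                (∑ j ∈ Finset.range (1 + 1), ∑ i ∈ Finset.range (j + 1),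
                  ((1 : ℕ).choose j : ℝ) * (j.choose i : ℝ) * 2 ^ (1 - j) *
                    ∫ u in (0 : ℝ)..1, (((Polynomial.C (1 / Δ') - X) ^ (1 - j) * (-(2 : ℝ) • (X ^ i * P))) *
                      derivative (derivative (X ^ (j - i) * P))).eval u) / 4)) / (2 * (π ^ 2 / 6) ^ 2)) := fun _ _ ↦ by rw [hτ]; norm_num
  have t13 : ∀ (Δ' : ℝ) (P : ℝ[X]), τ 1 3 Δ' P =
      (Δ' ^ 2 * (Δ' ^ 2 * 𝔎₁₃ (1 / Δ') P) / (2 * (π ^ 2 / 6) ^ 2)) := fun _ _ ↦ by rw [hτ]; norm_num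
  have t31 : ∀ (Δ' : ℝ) (P : ℝ[X]), τ 3 1 Δ' P =
      (Δ' ^ 2 * (Δ' ^ 2 * 𝔎₁₃ (1 / Δ') P) / (2 * (π ^ 2 / 6) ^ 2)) := fun _ _ ↦ by rw [hτ]; norm_num
  have t33 : ∀ (Δ' : ℝ) (P : ℝ[X]), τ 3 3 Δ' P =
      (Δ' ^ 2 * (Δ' ^ 4 * 𝔎₃₃ (1 / Δ') P) / (2 * (π ^ 2 / 6) ^ 2)) := fun _ _ ↦ by rw [hτ]; norm_num
  have t04 : ∀ (Δ' : ℝ) (P : ℝ[X]), τ 0 4 Δ' P =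
      (Δ' ^ 2 * (Δ' ^ 2 * 𝔎₀₄ (1 / Δ') P) / (2 * (π ^ 2 / 6) ^ 2)) := fun _ _ ↦ by rw [hτ]; norm_num
  have t40 : ∀ (Δ' : ℝ) (P : ℝ[X]), τ 4 0 Δ' P =
      (Δ' ^ 2 * (Δ' ^ 2 * 𝔎₀₄ (1 / Δ') P) / (2 * (π ^ 2 / 6) ^ 2)) := fun _ _ ↦ by rw [hτ]; norm_num
  have t24 : ∀ (Δ' : ℝ) (P : ℝ[X]), τ 2 4 Δ' P =
      (Δ' ^ 2 * (Δ' ^ 4 * 𝔎₂₄ (1 / Δ') P) / (2 * (π ^ 2 / 6) ^ 2)) := fun _ _ ↦ by rw [hτ]; norm_num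
  have t42 : ∀ (Δ' : ℝ) (P : ℝ[X]), τ 4 2 Δ' P =
      (Δ' ^ 2 * (Δ' ^ 4 * 𝔎₂₄ (1 / Δ') P) / (2 * (π ^ 2 / 6) ^ 2)) := fun _ _ ↦ by rw [hτ]; norm_num
  have t44 : ∀ (Δ' : ℝ) (P : ℝ[X]), τ 4 4 Δ' P =
      (Δ' ^ 2 * (Δ' ^ 6 * 𝔎₄₄ (1 / Δ') P) / (2 * (π ^ 2 / 6) ^ 2)) := fun _ _ ↦ by rw [hτ]; norm_num
  obtain ⟨C, q₀, hC⟩ := diagPart_asymp_of_selbergOrderAsymptotics_le hΔ 4 τ t00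
    (fun i j hi hj hij h00 P' hP' Δ'' h1' h2' ↦ by
      interval_cases i <;> interval_cases j
      · exact (h00 ⟨rfl, rfl⟩).elim
      · exact absurd hij (by decide)
      · rw [t02]
        exact orderZeroTwo_target hΔ P' hP' Δ'' h1' h2'
      · exact absurd hij (by decide)
      · rw [t04]
        exact h04 P' hP' Δ'' h1' h2'
      · exact absurd hij (by decide)
      · rw [t11]
        exact orderOneOne_target hΔ P' hP' Δ'' h1' h2'
      · exact absurd hij (by decide)
      · rw [t13]
        exact h13 P' hP' Δ'' h1' h2'
      · exact absurd hij (by decide)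
      · -- order `(2,0)` from `(0,2)` by the order symmetry
        obtain ⟨C, q₀, hC⟩ := orderZeroTwo_target hΔ P' hP' Δ'' h1' h2'
        obtain ⟨q₁, hq₁⟩ := exists_log_qhat_ge (1 : ℝ)
        refine ⟨C, max q₀ q₁, fun q _ hq ↦ ?_⟩
        have hl1 : (1 : ℝ) ≤ Real.log (qhat q) := hq₁ q (le_trans (le_max_right _ _) hq)
        have hQ : 0 < qhat q := lt_of_le_of_ne (by unfold qhat; positivity) fun h0 ↦ by
          rw [← h0, Real.log_zero] at hl1; linarith
        rw [t20, selbergOrder_symm 2 0 P' (qhat q ^ Δ'') ⌊qhat q ^ Δ''⌋₊ hQ, show (2 + 0 : ℕ) = 0 + 2 from rfl]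
        exact hC q (le_trans (le_max_left _ _) hq)
      · exact absurd hij (by decide)
      · rw [t22]
        exact h22 P' hP' Δ'' h1' h2'
      · exact absurd hij (by decide)
      · rw [t24]
        exact h24 P' hP' Δ'' h1' h2'
      · exact absurd hij (by decide)
      · -- order `(3,1)` from `(1,3)` by the order symmetry
        obtain ⟨C, q₀, hC⟩ := h13 P' hP' Δ'' h1' h2'
        obtain ⟨q₁, hq₁⟩ := exists_log_qhat_ge (1 : ℝ)
        refine ⟨C, max q₀ q₁, fun q _ hq ↦ ?_⟩
        have hl1 : (1 : ℝ) ≤ Real.log (qhat q) := hq₁ q (le_trans (le_max_right _ _) hq)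
        have hQ : 0 < qhat q := lt_of_le_of_ne (by unfold qhat; positivity) fun h0 ↦ by
          rw [← h0, Real.log_zero] at hl1; linarith
        rw [t31, selbergOrder_symm 3 1 P' (qhat q ^ Δ'') ⌊qhat q ^ Δ''⌋₊ hQ, show (3 + 1 : ℕ) = 1 + 3 from rfl]
        exact hC q (le_trans (le_max_left _ _) hq)
      · exact absurd hij (by decide)
      · rw [t33]
        exact h33 P' hP' Δ'' h1' h2'
      · exact absurd hij (by decide)
      · -- order `(4,0)` from `(0,4)` by the order symmetry
        obtain ⟨C, q₀, hC⟩ := h04 P' hP' Δ'' h1' h2'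
        obtain ⟨q₁, hq₁⟩ := exists_log_qhat_ge (1 : ℝ)
        refine ⟨C, max q₀ q₁, fun q _ hq ↦ ?_⟩
        have hl1 : (1 : ℝ) ≤ Real.log (qhat q) := hq₁ q (le_trans (le_max_right _ _) hq)
        have hQ : 0 < qhat q := lt_of_le_of_ne (by unfold qhat; positivity) fun h0 ↦ by
          rw [← h0, Real.log_zero] at hl1; linarith
        rw [t40, selbergOrder_symm 4 0 P' (qhat q ^ Δ'') ⌊qhat q ^ Δ''⌋₊ hQ, show (4 + 0 : ℕ) = 0 + 4 from rfl]
        exact hC q (le_trans (le_max_left _ _) hq)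
      · exact absurd hij (by decide)
      · -- order `(4,2)` from `(2,4)` by the order symmetry
        obtain ⟨C, q₀, hC⟩ := h24 P' hP' Δ'' h1' h2'
        obtain ⟨q₁, hq₁⟩ := exists_log_qhat_ge (1 : ℝ)
        refine ⟨C, max q₀ q₁, fun q _ hq ↦ ?_⟩
        have hl1 : (1 : ℝ) ≤ Real.log (qhat q) := hq₁ q (le_trans (le_max_right _ _) hq)
        have hQ : 0 < qhat q := lt_of_le_of_ne (by unfold qhat; positivity) fun h0 ↦ by
          rw [← h0, Real.log_zero] at hl1; linarith
        rw [t42, selbergOrder_symm 4 2 P' (qhat q ^ Δ'') ⌊qhat q ^ Δ''⌋₊ hQ, show (4 + 2 : ℕ) = 2 + 4 from rfl]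
        exact hC q (le_trans (le_max_left _ _) hq)
      · exact absurd hij (by decide)
      · rw [t44]
        exact h44 P' hP' Δ'' h1' h2')
    hP hQ h1 h2
  refine ⟨C, q₀, fun q _ hq ↦ ?_⟩
  have h := hC q hq
  have key : (∑ i ∈ Finset.range (Q.natDegree + 1), ∑ j ∈ Finset.range (Q.natDegree + 1),
      Q.coeff i * Q.coeff j * (1 + (-1 : ℝ) ^ (i + j)) * τ i j Δ' P) =
      Q.coeff 0 ^ 2 * KMV2000.secondMomentForm Δ' P 1 + 2 * Q.coeff 1 ^ 2 * τ 1 1 Δ' P +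
        4 * (Q.coeff 0 * Q.coeff 2) * τ 0 2 Δ' P + 2 * Q.coeff 2 ^ 2 * τ 2 2 Δ' P +
        4 * (Q.coeff 1 * Q.coeff 3) * τ 1 3 Δ' P + 2 * Q.coeff 3 ^ 2 * τ 3 3 Δ' P +
        4 * (Q.coeff 0 * Q.coeff 4) * τ 0 4 Δ' P + 4 * (Q.coeff 2 * Q.coeff 4) * τ 2 4 Δ' P +
        2 * Q.coeff 4 ^ 2 * τ 4 4 Δ' P := by
    have h20 : τ 2 0 Δ' P = τ 0 2 Δ' P := by rw [t20, t02]
    have h31 : τ 3 1 Δ' P = τ 1 3 Δ' P := by rw [t31, t13]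
    have h40 : τ 4 0 Δ' P = τ 0 4 Δ' P := by rw [t40, t04]
    have h42 : τ 4 2 Δ' P = τ 2 4 Δ' P := by rw [t42, t24]
    obtain hdeg | hdeg | hdeg | hdeg | hdeg : Q.natDegree = 0 ∨ Q.natDegree = 1 ∨ Q.natDegree = 2 ∨ Q.natDegree = 3 ∨
        Q.natDegree = 4 := by omega
    · have hc1 : Q.coeff 1 = 0 := Polynomial.coeff_eq_zero_of_natDegree_lt (by omega)
      have hc2 : Q.coeff 2 = 0 := Polynomial.coeff_eq_zero_of_natDegree_lt (by omega)
      have hc3 : Q.coeff 3 = 0 := Polynomial.coeff_eq_zero_of_natDegree_lt (by omega)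
      have hc4 : Q.coeff 4 = 0 := Polynomial.coeff_eq_zero_of_natDegree_lt (by omega)
      rw [hdeg, zero_add, Finset.sum_range_one, Finset.sum_range_one, t00, hc1, hc2, hc3, hc4]
      norm_num
      ring
    · have hc2 : Q.coeff 2 = 0 := Polynomial.coeff_eq_zero_of_natDegree_lt (by omega)
      have hc3 : Q.coeff 3 = 0 := Polynomial.coeff_eq_zero_of_natDegree_lt (by omega)
      have hc4 : Q.coeff 4 = 0 := Polynomial.coeff_eq_zero_of_natDegree_lt (by omega)
      rw [hdeg]
      simp only [Finset.sum_range_succ, Finset.sum_range_zero, zero_add, add_zero, pow_zero, pow_one, t00, hc2, hc3, hc4]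
      norm_num
      ring
    · have hc3 : Q.coeff 3 = 0 := Polynomial.coeff_eq_zero_of_natDegree_lt (by omega)
      have hc4 : Q.coeff 4 = 0 := Polynomial.coeff_eq_zero_of_natDegree_lt (by omega)
      rw [hdeg]
      simp only [Finset.sum_range_succ, Finset.sum_range_zero, zero_add, add_zero, pow_zero, pow_one, t00, h20, hc3, hc4]
      norm_num
      ring
    · have hc4 : Q.coeff 4 = 0 := Polynomial.coeff_eq_zero_of_natDegree_lt (by omega)
      rw [hdeg]
      simp only [Finset.sum_range_succ, Finset.sum_range_zero, zero_add, add_zero, pow_zero, pow_one, t00, h20, h31, hc4]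
      norm_num
      ring
    · rw [hdeg]
      simp only [Finset.sum_range_succ, Finset.sum_range_zero, zero_add, add_zero, pow_zero, pow_one, t00, h20, h31,
        h40, h42]
      norm_num
      ring
  rw [key, t11, t02, t22, t13, t33, t04, t24, t44] at h
  exact h

end Summit.Parity.GeneralizedHardyLittlewood.Theorems.MomentsBeyondDiagonal.DiagLines

end
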